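import Mathlib
import HarnessLib
import Summits.ValiantsHypothesis.ValiantsHypothesis.Theses.NewtonUnitEquations
import Summits.ValiantsHypothesis.ValiantsHypothesis.Theorems.NewtonUnitEquationsFewProductsBoundCruxEquiv

/-!
# Route NewtonUnitEquations — `FewProductsBound` (stmt-ValiantsHypothesis-16052): which regime
# restrictions of the crux are degenerate, and the ONE-PARAMETER normal form of `NewtonTauWeak`

Support file (prover, item stmt-ValiantsHypothesis-16052, `--supports`).  The companion file
`NewtonUnitEquationsFewProductsBoundCruxEquiv.lean` proved that the item `FewProductsBound`
(`k ≤ 2^m → vert ≤ 2^(a m) (t+2)^b`) is equivalent to the crux `NewtonTauWeak`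
(`vert ≤ 2^(a m) (k t+2)^b`, KPTT arXiv:1308.2286, weak form; open).  Here the mechanism is
isolated as two PADDING META-THEOREMS, so that the planner can read off which "regime splits"
`R k m t` of the crux are proper and which are the crux in disguise, and it is pushed to its end:
the three-parameter crux is equivalent to a ONE-parameter statement.

* `newtonTauWeak_of_regime_padFactors`: if every `(k, m, t)` (`k, t ≥ 1`) reaches the regime `R` by
  ADDING `n` FACTORS with `2^n ≤ 2^(c m) (k t + 2)^c`, then the crux restricted to `R` implies the crux
  (pad every product with `n` factors equal to `1`; the `2^(a m)` budget absorbs `2^(a n)`).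
* `newtonTauWeak_of_regime_padProducts`: if every `(k, m, t)` (`k, m, t ≥ 1`) reaches `R` by ADDING
  `K` PRODUCTS with `K ≤ 2^(c m) (k t + 2)^c`, then again the restricted crux implies the crux (append
  `K` zero products; the `(k t + 2)^b` budget absorbs `K t`).
* Instances: the regimes `k ≤ 2^m ∧ t ≤ 2^m` ("few products AND low sparsity") and
  `m ≤ ⌊log₂ k⌋ ∧ t ≤ k` ("few factors and low sparsity relative to k") are each crux-equivalent
  (`newtonTauWeak_iff_fewProductsLowSparsity`, `newtonTauWeak_iff_logFactorsLowSparsity`) — so no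
  threshold split in `(k, m, t)` along exponential/logarithmic scales is proper; a proper sub-regime
  must cut `t` (or `k`) below what padding reaches, e.g. `t ≤ m` or `k ≤ m`.
* `newtonTauWeak_iff_oneParam`: **`NewtonTauWeak ↔ ∃ a, ∀ n (f : Fin (2^n) → Fin n → ℂ[X,Y]),
  (every factor has ≤ 2^n monomials) → vert(Σ_i Π_j f_ij) ≤ 2^(a n)`** — sums of `2^n` products of
  `n` polynomials with `2^n` monomials each have `2^(O(n))` Newton vertices (trivially `2^(O(n²))`;
  KPTT's convexity bound gives `2^(n + 2n²/3)`); with `N = 2^n`: `N` products of `log₂ N` factors,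
  each `N`-sparse, have `poly(N)` vertices.  `fewProductsBound_iff_oneParam`: the same for the item.

No definitions, no named facts, elementary arithmetic only; `vert` and the padding lemmas are reused
from `Theorems/NewtonTauWeak/Negative/*.lean` and the companion file.
-/

-- `<Problem> = <Summit>` for this single-conjunct summit: every decl is `Summit.ValiantsHypothesis.ValiantsHypothesis.…`
-- by the layout (D-0017), which the dupNamespace linter flags; the lakefile sets the same option tree-wide.
set_option linter.dupNamespace false

namespace Summit.ValiantsHypothesis.ValiantsHypothesis.Theorems.NewtonUnitEquationsFewProductsBoundNormalForm

open scoped BigOperators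
open MvPolynomial
open Summit.ValiantsHypothesis.ValiantsHypothesis.Theses.NewtonUnitEquations (NewtonTauWeak)
open Summit.ValiantsHypothesis.ValiantsHypothesis.Theorems.NewtonTauWeak.Negative
  (vert vert_le_card_support vert_sum_fin_zero vert_sum_fin_zero')
open Summit.ValiantsHypothesis.ValiantsHypothesis.Theorems.NewtonUnitEquationsFewProductsBound
  (sum_prod_append_one card_support_append_one_le sum_prod_append_zero card_support_append_zero_le
    vert_le_one_of_forall_eq_zero forall_eq_zero_of_card_support_le_zero sum_prod_pad_products
    fewProductsBound_iff_newtonTauWeak newtonTauWeak_of_fewProductsBound)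

/-! ## §1 Padding meta-theorems: which regime restrictions are the crux in disguise -/

/-- **Crux ⇒ restricted crux** (trivial direction, any regime `R`, same constants). -/
theorem regime_of_newtonTauWeak (R : ℕ → ℕ → ℕ → Prop) (h : NewtonTauWeak) :
    ∃ a b : ℕ, ∀ (k m t : ℕ) (f : Fin k → Fin m → MvPolynomial (Fin 2) ℂ), R k m t →
      (∀ i j, (f i j).support.card ≤ t) → vert (∑ i, ∏ j, f i j) ≤ 2 ^ (a * m) * (k * t + 2) ^ b := by
  obtain ⟨a, b, h⟩ := h
  exact ⟨a, b, fun k m t f _ hf => h k m t f hf⟩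

/-- **Padding meta-theorem (factors).** Let `R k m t` be any regime predicate.  If every parameter
triple with `0 < k`, `0 < t` reaches the regime by adding `n` factors, where `2^n ≤ 2^(c m) (k t + 2)^c`,
then the crux RESTRICTED to `R` (with the crux's own bound shape `2^(a m) (k t + 2)^b`) implies the full
crux `NewtonTauWeak`, with constants `(a (c+1), a c + b)`: pad every product with `n` factors equal to
`1` (the polynomial and the sparsity are unchanged) and absorb `2^(a n) ≤ 2^(a c m) (k t + 2)^(a c)`.
(`t = 0`: all factors vanish, `≤ 1` vertex; `k = 0`: empty sum.) -/
theorem newtonTauWeak_of_regime_padFactors (R : ℕ → ℕ → ℕ → Prop) (c : ℕ)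
    (hR : ∀ k m t : ℕ, 0 < k → 0 < t → ∃ n : ℕ, R k (m + n) t ∧ 2 ^ n ≤ 2 ^ (c * m) * (k * t + 2) ^ c)
    (h : ∃ a b : ℕ, ∀ (k m t : ℕ) (f : Fin k → Fin m → MvPolynomial (Fin 2) ℂ), R k m t →
      (∀ i j, (f i j).support.card ≤ t) → vert (∑ i, ∏ j, f i j) ≤ 2 ^ (a * m) * (k * t + 2) ^ b) :
    NewtonTauWeak := by
  obtain ⟨a, b, h⟩ := h
  refine ⟨a * (c + 1), a * c + b, ?_⟩
  intro k m t f hf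
  change vert (∑ i, ∏ j, f i j) ≤ _
  have hpos : 1 ≤ 2 ^ (a * (c + 1) * m) * (k * t + 2) ^ (a * c + b) :=
    Nat.one_le_iff_ne_zero.mpr (by positivity)
  rcases Nat.eq_zero_or_pos t with rfl | htpos
  · exact (vert_le_one_of_forall_eq_zero f (forall_eq_zero_of_card_support_le_zero f hf)).trans hpos
  rcases Nat.eq_zero_or_pos k with rfl | hkpos
  · rw [vert_sum_fin_zero]; exact Nat.zero_le _
  obtain ⟨n, hRn, h2n⟩ := hR k m t hkpos htpos
  have H := h k (m + n) t (fun i => Fin.append (f i) (fun _ : Fin n => (1 : MvPolynomial (Fin 2) ℂ)))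
    hRn (card_support_append_one_le n f hf htpos)
  rw [sum_prod_append_one n f] at H
  refine H.trans ?_
  calc 2 ^ (a * (m + n)) * (k * t + 2) ^ b = 2 ^ (a * m) * (2 ^ n) ^ a * (k * t + 2) ^ b := by
        rw [mul_add, pow_add, mul_comm a n, pow_mul (2 : ℕ) n a]
    _ ≤ 2 ^ (a * m) * (2 ^ (c * m) * (k * t + 2) ^ c) ^ a * (k * t + 2) ^ b :=
        Nat.mul_le_mul_right _ (Nat.mul_le_mul_left _ (Nat.pow_le_pow_left h2n _))
    _ = 2 ^ (a * (c + 1) * m) * (k * t + 2) ^ (a * c + b) := by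
        rw [mul_pow, ← pow_mul, ← pow_mul]; ring

/-- **Padding meta-theorem (products).** If every parameter triple with `0 < k`, `0 < m`, `0 < t`
reaches the regime `R` by adding `K` products, where `K ≤ 2^(c m) (k t + 2)^c`, then the crux
restricted to `R` implies `NewtonTauWeak`, with constants `(a + b c, b (c + 2))`: append `K` zero
products (for `m ≥ 1` a product with a zero factor vanishes, so the polynomial is unchanged) and absorb
`(k + K) t + 2 ≤ 2^(c m) (k t + 2)^(c+2)`.  (`m = 0`: the sum is the constant `k`, `≤ 1` vertex;
`k = 0`: empty sum; `t = 0`: all factors vanish.) -/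
theorem newtonTauWeak_of_regime_padProducts (R : ℕ → ℕ → ℕ → Prop) (c : ℕ)
    (hR : ∀ k m t : ℕ, 0 < k → 0 < m → 0 < t →
      ∃ K : ℕ, R (k + K) m t ∧ K ≤ 2 ^ (c * m) * (k * t + 2) ^ c)
    (h : ∃ a b : ℕ, ∀ (k m t : ℕ) (f : Fin k → Fin m → MvPolynomial (Fin 2) ℂ), R k m t →
      (∀ i j, (f i j).support.card ≤ t) → vert (∑ i, ∏ j, f i j) ≤ 2 ^ (a * m) * (k * t + 2) ^ b) :
    NewtonTauWeak := by
  obtain ⟨a, b, h⟩ := h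
  refine ⟨a + b * c, b * (c + 2), ?_⟩
  intro k m t f hf
  change vert (∑ i, ∏ j, f i j) ≤ _
  have hpos : 1 ≤ 2 ^ ((a + b * c) * m) * (k * t + 2) ^ (b * (c + 2)) :=
    Nat.one_le_iff_ne_zero.mpr (by positivity)
  rcases Nat.eq_zero_or_pos m with rfl | hmpos
  · exact (vert_sum_fin_zero' k f).trans hpos
  rcases Nat.eq_zero_or_pos k with rfl | hkpos
  · rw [vert_sum_fin_zero]; exact Nat.zero_le _
  rcases Nat.eq_zero_or_pos t with rfl | htpos
  · exact (vert_le_one_of_forall_eq_zero f (forall_eq_zero_of_card_support_le_zero f hf)).trans hpos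
  obtain ⟨K, hRK, hK⟩ := hR k m t hkpos hmpos htpos
  have H := h (k + K) m t
    (Fin.append f (fun (_ : Fin K) (_ : Fin m) => (0 : MvPolynomial (Fin 2) ℂ))) hRK
    (card_support_append_zero_le K f hf)
  rw [sum_prod_append_zero hmpos K f] at H
  refine H.trans ?_
  -- arithmetic: `(k + K) t + 2 ≤ 2^(c m) (k t + 2)^(c + 2)`
  set X : ℕ := k * t + 2 with hX
  have hX2 : 2 ≤ X := by omega
  have htX : t ≤ X := by
    have : t ≤ k * t := Nat.le_mul_of_pos_left t hkpos
    omega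
  have h1 : 1 ≤ 2 ^ (c * m) := Nat.one_le_two_pow
  have hKt : K * t ≤ 2 ^ (c * m) * X ^ (c + 1) :=
    calc K * t ≤ 2 ^ (c * m) * X ^ c * X := Nat.mul_le_mul hK htX
      _ = 2 ^ (c * m) * X ^ (c + 1) := by rw [pow_succ, mul_assoc]
  have hXX : X ≤ 2 ^ (c * m) * X ^ (c + 1) :=
    calc X = 1 * X ^ 1 := by rw [one_mul, pow_one]
      _ ≤ 2 ^ (c * m) * X ^ (c + 1) :=
          Nat.mul_le_mul h1 (Nat.pow_le_pow_right (by omega) (by omega))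
  have hkey : (k + K) * t + 2 ≤ 2 ^ (c * m) * X ^ (c + 2) :=
    calc (k + K) * t + 2 = X + K * t := by rw [hX]; ring
      _ ≤ 2 * (2 ^ (c * m) * X ^ (c + 1)) := by omega
      _ ≤ X * (2 ^ (c * m) * X ^ (c + 1)) := Nat.mul_le_mul_right _ hX2
      _ = 2 ^ (c * m) * X ^ (c + 2) := by ring
  calc 2 ^ (a * m) * ((k + K) * t + 2) ^ b ≤ 2 ^ (a * m) * (2 ^ (c * m) * X ^ (c + 2)) ^ b :=
        Nat.mul_le_mul_left _ (Nat.pow_le_pow_left hkey _)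
    _ = 2 ^ ((a + b * c) * m) * X ^ (b * (c + 2)) := by
        rw [mul_pow, ← pow_mul, ← pow_mul]; ring

/-! ## §2 Two instances: adding a sparsity threshold does not make the regimes proper -/

/-- **"Few products and low sparsity" is still the whole crux.** The crux restricted to
`k ≤ 2^m ∧ t ≤ 2^m` is equivalent to `NewtonTauWeak`: from any `(k, m, t)` add
`n = ⌊log₂ k⌋ + ⌊log₂ t⌋ + 2` unit factors (`2^n ≤ 4 k t ≤ (k t + 2)^2`).  In particular the item
`FewProductsBound` stays crux-equivalent even after imposing `t ≤ 2^m`. -/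
theorem newtonTauWeak_iff_fewProductsLowSparsity :
    NewtonTauWeak ↔
    ∃ a b : ℕ, ∀ (k m t : ℕ) (f : Fin k → Fin m → MvPolynomial (Fin 2) ℂ), (k ≤ 2 ^ m ∧ t ≤ 2 ^ m) →
      (∀ i j, (f i j).support.card ≤ t) → vert (∑ i, ∏ j, f i j) ≤ 2 ^ (a * m) * (k * t + 2) ^ b := by
  refine ⟨regime_of_newtonTauWeak _, newtonTauWeak_of_regime_padFactors _ 2 ?_⟩
  intro k m t hk ht
  refine ⟨Nat.log 2 k + Nat.log 2 t + 2, ⟨?_, ?_⟩, ?_⟩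
  · calc k ≤ 2 ^ (Nat.log 2 k + 1) := (Nat.lt_pow_succ_log_self one_lt_two k).le
      _ ≤ 2 ^ (m + (Nat.log 2 k + Nat.log 2 t + 2)) := Nat.pow_le_pow_right (by norm_num) (by omega)
  · calc t ≤ 2 ^ (Nat.log 2 t + 1) := (Nat.lt_pow_succ_log_self one_lt_two t).le
      _ ≤ 2 ^ (m + (Nat.log 2 k + Nat.log 2 t + 2)) := Nat.pow_le_pow_right (by norm_num) (by omega)
  · have hk' : 2 ^ Nat.log 2 k ≤ k := Nat.pow_log_le_self 2 hk.ne'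
    have ht' : 2 ^ Nat.log 2 t ≤ t := Nat.pow_log_le_self 2 ht.ne'
    have h1 : 1 ≤ 2 ^ (2 * m) := Nat.one_le_two_pow
    calc 2 ^ (Nat.log 2 k + Nat.log 2 t + 2) = 2 ^ Nat.log 2 k * 2 ^ Nat.log 2 t * 4 := by
          rw [pow_add, pow_add]; norm_num
      _ ≤ k * t * 4 := Nat.mul_le_mul_right _ (Nat.mul_le_mul hk' ht')
      _ ≤ (k * t + 2) ^ 2 := by nlinarith [sq_nonneg (k * t)]
      _ = 1 * (k * t + 2) ^ 2 := (one_mul _).symm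
      _ ≤ 2 ^ (2 * m) * (k * t + 2) ^ 2 := Nat.mul_le_mul_right _ h1

/-- **"Few factors and low sparsity relative to `k`" is still the whole crux.** The crux restricted
to `m ≤ ⌊log₂ k⌋ ∧ t ≤ k` is equivalent to `NewtonTauWeak`: from any `(k, m, t)` with `k, m, t ≥ 1`
append `K = 2^m + t` zero products (`K ≤ 2^m (k t + 2)`).  In particular the sibling item
`LogFactorBound` (stmt-ValiantsHypothesis-16048) stays crux-equivalent even after imposing `t ≤ k`. -/
theorem newtonTauWeak_iff_logFactorsLowSparsity :
    NewtonTauWeak ↔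
    ∃ a b : ℕ, ∀ (k m t : ℕ) (f : Fin k → Fin m → MvPolynomial (Fin 2) ℂ),
      (m ≤ Nat.log 2 k ∧ t ≤ k) →
      (∀ i j, (f i j).support.card ≤ t) → vert (∑ i, ∏ j, f i j) ≤ 2 ^ (a * m) * (k * t + 2) ^ b := by
  refine ⟨regime_of_newtonTauWeak _, newtonTauWeak_of_regime_padProducts _ 1 ?_⟩
  intro k m t hk _hm ht
  refine ⟨2 ^ m + t, ⟨?_, le_add_left le_add_self⟩, ?_⟩
  · exact Nat.le_log_of_pow_le one_lt_two (le_add_left le_self_add)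
  · have h1 : 1 ≤ 2 ^ (1 * m) := Nat.one_le_two_pow
    have hkt : t ≤ k * t := Nat.le_mul_of_pos_left t hk
    calc 2 ^ m + t ≤ 2 ^ (1 * m) * 1 + 2 ^ (1 * m) * (k * t) := by
          rw [one_mul m, mul_one]
          exact Nat.add_le_add_left (hkt.trans (Nat.le_mul_of_pos_left _ (by positivity))) _
      _ ≤ 2 ^ (1 * m) * (k * t + 2) ^ 1 := by rw [pow_one]; nlinarith

/-! ## §3 The one-parameter normal form -/

/-- **One-parameter normal form of KPTT's weak Newton-polygon τ-conjecture.**  `NewtonTauWeak`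
(parameters `k, m, t`) is equivalent to: *there is `a` such that every sum of `2^n` products of `n`
bivariate complex polynomials with at most `2^n` monomials each has at most `2^(a n)` Newton-polygon
vertices* — in one size parameter `N = 2^n`: sums of `N` products of `log₂ N` polynomials that are
`N`-sparse have `poly(N)` vertices (trivial bound `N^(log₂ N + 1)`, KPTT Thm 6 gives
`N^(2 log₂ N / 3 + 1)`).  (`⇒`: instance `k = t = 2^n`, `m = n`, and `(2^n·2^n + 2)^b ≤ 2^(3 b n)` for
`n ≥ 1`; `n = 0` is the constant `1`.  `⇐`: by `newtonTauWeak_of_fewProductsBound` it suffices to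
treat `k ≤ 2^m`; add `n' = ⌊log₂ t⌋ + 1` unit factors so that also `t ≤ 2^(m+n')`, fill up with zero
products to exactly `2^(m+n')` products, and absorb `2^(a n') ≤ (2 t)^a ≤ (t + 2)^(2 a)`.) -/
theorem newtonTauWeak_iff_oneParam :
    NewtonTauWeak ↔
    ∃ a : ℕ, ∀ (n : ℕ) (f : Fin (2 ^ n) → Fin n → MvPolynomial (Fin 2) ℂ),
      (∀ i j, (f i j).support.card ≤ 2 ^ n) →
        (Set.extremePoints ℝ (convexHull ℝ ((fun e : Fin 2 →₀ ℕ => fun i : Fin 2 => ((e i : ℕ) : ℝ)) ''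
          ((∑ i, ∏ j, f i j).support : Set (Fin 2 →₀ ℕ))))).ncard ≤ 2 ^ (a * n) := by
  constructor
  · rintro ⟨a, b, h⟩
    refine ⟨a + 3 * b, fun n f hf => ?_⟩
    change vert (∑ i, ∏ j, f i j) ≤ _
    rcases Nat.eq_zero_or_pos n with rfl | hnpos
    · exact (vert_sum_fin_zero' _ f).trans Nat.one_le_two_pow
    have H : vert (∑ i, ∏ j, f i j) ≤ 2 ^ (a * n) * (2 ^ n * 2 ^ n + 2) ^ b := h (2 ^ n) n (2 ^ n) f hf
    refine H.trans ?_
    have h2 : 2 ≤ 2 ^ n := by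
      calc (2 : ℕ) = 2 ^ 1 := (pow_one 2).symm
        _ ≤ 2 ^ n := Nat.pow_le_pow_right (by norm_num) hnpos
    have hkey : 2 ^ n * 2 ^ n + 2 ≤ 2 ^ (3 * n) := by
      have e3 : 2 ^ (3 * n) = 2 ^ n * 2 ^ n * 2 ^ n := by
        rw [show 3 * n = n + n + n by ring, pow_add, pow_add]
      rw [e3]
      have hsq : 1 ≤ 2 ^ n * 2 ^ n := Nat.one_le_iff_ne_zero.mpr (by positivity)
      nlinarith
    calc 2 ^ (a * n) * (2 ^ n * 2 ^ n + 2) ^ b ≤ 2 ^ (a * n) * (2 ^ (3 * n)) ^ b :=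
          Nat.mul_le_mul_left _ (Nat.pow_le_pow_left hkey _)
      _ = 2 ^ ((a + 3 * b) * n) := by rw [← pow_mul, ← pow_add]; ring_nf
  · rintro ⟨a, h⟩
    refine newtonTauWeak_of_fewProductsBound ⟨a, 2 * a, ?_⟩
    intro k m t f hk hf
    change vert (∑ i, ∏ j, f i j) ≤ _
    have hpos : 1 ≤ 2 ^ (a * m) * (t + 2) ^ (2 * a) := Nat.one_le_iff_ne_zero.mpr (by positivity)
    rcases Nat.eq_zero_or_pos t with rfl | htpos
    · exact (vert_le_one_of_forall_eq_zero f (forall_eq_zero_of_card_support_le_zero f hf)).trans hpos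
    -- add `n` unit factors so that `t ≤ 2^(m+n)`, then fill up with zero products to `2^(m+n)` products
    set n : ℕ := Nat.log 2 t + 1 with hn
    have htn : t ≤ 2 ^ n := (Nat.lt_pow_succ_log_self one_lt_two t).le
    have hmn : 0 < m + n := by omega
    have hpow : 2 ^ m ≤ 2 ^ (m + n) := Nat.pow_le_pow_right (by norm_num) (Nat.le_add_right m n)
    have hk' : k ≤ 2 ^ (m + n) := hk.trans hpow
    have ht' : t ≤ 2 ^ (m + n) := htn.trans (Nat.pow_le_pow_right (by norm_num) (Nat.le_add_left n m))
    let g : Fin k → Fin (m + n) → MvPolynomial (Fin 2) ℂ :=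
      fun i => Fin.append (f i) (fun _ : Fin n => (1 : MvPolynomial (Fin 2) ℂ))
    have hg : ∀ i j, (g i j).support.card ≤ t := card_support_append_one_le n f hf htpos
    have H := h (m + n) (fun i j => if hi : (i : ℕ) < k then g ⟨i, hi⟩ j else 0) (by
      intro i j
      split_ifs with hi
      · exact (hg _ _).trans ht'
      · simp)
    change vert _ ≤ _ at H
    rw [sum_prod_pad_products hk' hmn g, sum_prod_append_one n f] at H
    refine H.trans ?_
    have h2n : 2 ^ n ≤ (t + 2) ^ 2 := by
      have h1 : 2 ^ n ≤ 2 * t := by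
        rw [hn, pow_succ]
        have := Nat.pow_log_le_self 2 htpos.ne'
        omega
      nlinarith [sq_nonneg t]
    calc 2 ^ (a * (m + n)) = 2 ^ (a * m) * (2 ^ n) ^ a := by
          rw [mul_add, pow_add, mul_comm a n, pow_mul (2 : ℕ) n a]
      _ ≤ 2 ^ (a * m) * ((t + 2) ^ 2) ^ a := Nat.mul_le_mul_left _ (Nat.pow_le_pow_left h2n _)
      _ = 2 ^ (a * m) * (t + 2) ^ (2 * a) := by rw [← pow_mul]

/-- **The item in one parameter.** `FewProductsBound` (stmt-ValiantsHypothesis-16052, literal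
signature on the left) is equivalent to the one-parameter statement of `newtonTauWeak_iff_oneParam`
— hence to the crux stmt-ValiantsHypothesis-5904 and to KPTT's open weak conjecture. -/
theorem fewProductsBound_iff_oneParam :
    (∃ a b : ℕ, ∀ (k m t : ℕ) (f : Fin k → Fin m → MvPolynomial (Fin 2) ℂ), k ≤ 2 ^ m →
      (∀ i j, (f i j).support.card ≤ t) →
        (Set.extremePoints ℝ (convexHull ℝ ((fun e : Fin 2 →₀ ℕ => fun i : Fin 2 => ((e i : ℕ) : ℝ)) ''
          ((∑ i, ∏ j, f i j).support : Set (Fin 2 →₀ ℕ))))).ncard ≤ 2 ^ (a * m) * (t + 2) ^ b) ↔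
    ∃ a : ℕ, ∀ (n : ℕ) (f : Fin (2 ^ n) → Fin n → MvPolynomial (Fin 2) ℂ),
      (∀ i j, (f i j).support.card ≤ 2 ^ n) →
        (Set.extremePoints ℝ (convexHull ℝ ((fun e : Fin 2 →₀ ℕ => fun i : Fin 2 => ((e i : ℕ) : ℝ)) ''
          ((∑ i, ∏ j, f i j).support : Set (Fin 2 →₀ ℕ))))).ncard ≤ 2 ^ (a * n) :=
  fewProductsBound_iff_newtonTauWeak.trans newtonTauWeak_iff_oneParam

end Summit.ValiantsHypothesis.ValiantsHypothesis.Theorems.NewtonUnitEquationsFewProductsBoundNormalForm
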